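import Summits.CriticalPhenomena.PercolationContinuityZ3.Theorems.PercNearOneGluingNoHeavyLowerTailSahiE3LroCube
import Mathlib.Tactic.FinCases
import HarnessLib
import HarnessLib.Audit

/-!
# `NoHeavyLowerTail` (crux stmt-CriticalPhenomena-4575), Sahi programme P4 (Holley / monotone coupling):
# linear read-once slots — the headline examples: `x_a ∨ (x_b ∧ (x_c ∨ x_d))`, `x_a ∨ (x_b ∧ x_c ∧ x_d)`, `x_a ∨ x_b ∨ (x_c ∧ x_d)`

Support file (cell `prim-l12`, seat P4, generation 11; `--supports stmt-CriticalPhenomena-4575`).  No named facts, no sorries;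
standard axioms; def-free.

Readable instances of `…SahiE3LroCube.latticeE3_nonneg_lro_prod` (Kahn's Conjecture 5 for every linear read-once first slot under
product weights on `2^κ`): the three four-variable linear read-once slots that are NOT covered by the three-primes capstone
(`…SahiE3ThreePrimes`) nor by the hitting / filter theorems — `1+23+24` (the hard-core pattern of the k = 5 atlas), `1+234`, `1+2+34` —
stated with explicit events `{ω | a ∈ ω ∨ (b ∈ ω ∧ (c ∈ ω ∨ d ∈ ω))}` etc., every product weight `∏_{u∈ω} θ_u`, all up-sets `A, B`.
-/

/-! ## Linear read-once slots: the headline examples on `2^κ` -/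

namespace Summit.CriticalPhenomena.PercolationContinuityZ3.Theorems.SahiE3LroExamples

open Finset Literature.Probability.LatticeModels
open scoped BigOperators

variable {κ : Type*} [Fintype κ] [DecidableEq κ]

/-- Evaluation of the three-operator fold at a pattern: `x₀ ∘₀ (x₁ ∘₁ (x₂ ∘₂ x₃))`. [this work] -/
theorem foldr_three (ops : Fin 3 → Bool) (t : Fin 4 → Bool) :
    Fin.foldr 3 (fun i b => bif ops i then (t i.castSucc || b) else (t i.castSucc && b)) (t (Fin.last 3)) =
      (bif ops 0 then (t 0 || (bif ops 1 then (t 1 || (bif ops 2 then (t 2 || t 3) else (t 2 && t 3)))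
        else (t 1 && (bif ops 2 then (t 2 || t 3) else (t 2 && t 3)))))
      else (t 0 && (bif ops 1 then (t 1 || (bif ops 2 then (t 2 || t 3) else (t 2 && t 3)))
        else (t 1 && (bif ops 2 then (t 2 || t 3) else (t 2 && t 3)))))) := by
  simp only [Fin.foldr_succ, Fin.foldr_zero]
  rfl

omit [Fintype κ] [DecidableEq κ] in
/-- Injectivity of a 4-tuple of distinct elements. [folklore] -/
theorem injective_four {a b c d : κ} (hab : a ≠ b) (hac : a ≠ c) (had : a ≠ d) (hbc : b ≠ c) (hbd : b ≠ d)
    (hcd : c ≠ d) : Function.Injective (![a, b, c, d] : Fin 4 → κ) := by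
  intro i j h
  fin_cases i <;> fin_cases j <;> simp_all [Matrix.cons_val_zero, Matrix.cons_val_one]

/-- **Kahn's Conjecture 5 for the slot "`a` is open, or `b` is open and one of `c, d` is open"** — the hard-core pattern
`1+23+24 = x_a ∨ (x_b ∧ (x_c ∨ x_d))` of the k = 5 atlas (HOME prim-l12-p4/STATUS) — under every product weight
`μ(ω) = ∏_{u∈ω} θ_u` (`θ ≥ 0`) on `2^κ`, for ALL up-sets `A, B`. [this work] -/
theorem latticeE3_nonneg_orAndOr_prod {θ : κ → ℝ} (hθ : ∀ u, 0 ≤ θ u) {a b c d : κ} (hab : a ≠ b) (hac : a ≠ c)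
    (had : a ≠ d) (hbc : b ≠ c) (hbd : b ≠ d) (hcd : c ≠ d) {A B : Finset (Finset κ)}
    (hA : IsUpperSet (A : Set (Finset κ))) (hB : IsUpperSet (B : Set (Finset κ))) :
    0 ≤ latticeE3 (fun ω : Finset κ => ∏ u ∈ ω, θ u)
      (univ.filter fun ω : Finset κ => a ∈ ω ∨ (b ∈ ω ∧ (c ∈ ω ∨ d ∈ ω))) A B := by
  have key := SahiE3LroCube.latticeE3_nonneg_lro_prod hθ 3 ![true, false, true] (injective_four hab hac had hbc hbd hcd) hA hB
    (univ.filter fun t : Fin 4 → Bool => Fin.foldr 3 (fun i bb => bif (![true, false, true] : Fin 3 → Bool) i then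
      (t i.castSucc || bb) else (t i.castSucc && bb)) (t (Fin.last 3)) = true) (fun t => by simp)
  have hs : (univ.filter fun ω : Finset κ => (fun i => decide ((![a, b, c, d] : Fin 4 → κ) i ∈ ω)) ∈
      univ.filter fun t : Fin 4 → Bool => Fin.foldr 3 (fun i bb => bif (![true, false, true] : Fin 3 → Bool) i then
        (t i.castSucc || bb) else (t i.castSucc && bb)) (t (Fin.last 3)) = true) =
      univ.filter fun ω : Finset κ => a ∈ ω ∨ (b ∈ ω ∧ (c ∈ ω ∨ d ∈ ω)) := by
    ext ω
    simp only [Finset.mem_filter, Finset.mem_univ, true_and, foldr_three]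
    simp
  rw [hs] at key
  exact key

/-- **Kahn's Conjecture 5 for the slot "`a` is open, or all of `b, c, d` are open"** (`x_a ∨ (x_b ∧ x_c ∧ x_d)`, pattern `1+234`),
every product weight on `2^κ`, all up-sets `A, B`. [this work] -/
theorem latticeE3_nonneg_orAndAnd_prod {θ : κ → ℝ} (hθ : ∀ u, 0 ≤ θ u) {a b c d : κ} (hab : a ≠ b) (hac : a ≠ c)
    (had : a ≠ d) (hbc : b ≠ c) (hbd : b ≠ d) (hcd : c ≠ d) {A B : Finset (Finset κ)}
    (hA : IsUpperSet (A : Set (Finset κ))) (hB : IsUpperSet (B : Set (Finset κ))) :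
    0 ≤ latticeE3 (fun ω : Finset κ => ∏ u ∈ ω, θ u)
      (univ.filter fun ω : Finset κ => a ∈ ω ∨ (b ∈ ω ∧ c ∈ ω ∧ d ∈ ω)) A B := by
  have key := SahiE3LroCube.latticeE3_nonneg_lro_prod hθ 3 ![true, false, false] (injective_four hab hac had hbc hbd hcd) hA hB
    (univ.filter fun t : Fin 4 → Bool => Fin.foldr 3 (fun i bb => bif (![true, false, false] : Fin 3 → Bool) i then
      (t i.castSucc || bb) else (t i.castSucc && bb)) (t (Fin.last 3)) = true) (fun t => by simp)
  have hs : (univ.filter fun ω : Finset κ => (fun i => decide ((![a, b, c, d] : Fin 4 → κ) i ∈ ω)) ∈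
      univ.filter fun t : Fin 4 → Bool => Fin.foldr 3 (fun i bb => bif (![true, false, false] : Fin 3 → Bool) i then
        (t i.castSucc || bb) else (t i.castSucc && bb)) (t (Fin.last 3)) = true) =
      univ.filter fun ω : Finset κ => a ∈ ω ∨ (b ∈ ω ∧ c ∈ ω ∧ d ∈ ω) := by
    ext ω
    simp only [Finset.mem_filter, Finset.mem_univ, true_and, foldr_three]
    simp
  rw [hs] at key
  exact key

/-- **Kahn's Conjecture 5 for the slot "`a` or `b` is open, or both `c, d` are open"** (`x_a ∨ x_b ∨ (x_c ∧ x_d)`, pattern `1+2+34`),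
every product weight on `2^κ`, all up-sets `A, B`. [this work] -/
theorem latticeE3_nonneg_orOrAnd_prod {θ : κ → ℝ} (hθ : ∀ u, 0 ≤ θ u) {a b c d : κ} (hab : a ≠ b) (hac : a ≠ c)
    (had : a ≠ d) (hbc : b ≠ c) (hbd : b ≠ d) (hcd : c ≠ d) {A B : Finset (Finset κ)}
    (hA : IsUpperSet (A : Set (Finset κ))) (hB : IsUpperSet (B : Set (Finset κ))) :
    0 ≤ latticeE3 (fun ω : Finset κ => ∏ u ∈ ω, θ u)
      (univ.filter fun ω : Finset κ => a ∈ ω ∨ b ∈ ω ∨ (c ∈ ω ∧ d ∈ ω)) A B := by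
  have key := SahiE3LroCube.latticeE3_nonneg_lro_prod hθ 3 ![true, true, false] (injective_four hab hac had hbc hbd hcd) hA hB
    (univ.filter fun t : Fin 4 → Bool => Fin.foldr 3 (fun i bb => bif (![true, true, false] : Fin 3 → Bool) i then
      (t i.castSucc || bb) else (t i.castSucc && bb)) (t (Fin.last 3)) = true) (fun t => by simp)
  have hs : (univ.filter fun ω : Finset κ => (fun i => decide ((![a, b, c, d] : Fin 4 → κ) i ∈ ω)) ∈
      univ.filter fun t : Fin 4 → Bool => Fin.foldr 3 (fun i bb => bif (![true, true, false] : Fin 3 → Bool) i then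
        (t i.castSucc || bb) else (t i.castSucc && bb)) (t (Fin.last 3)) = true) =
      univ.filter fun ω : Finset κ => a ∈ ω ∨ b ∈ ω ∨ (c ∈ ω ∧ d ∈ ω) := by
    ext ω
    simp only [Finset.mem_filter, Finset.mem_univ, true_and, foldr_three]
    simp
  rw [hs] at key
  exact key

end Summit.CriticalPhenomena.PercolationContinuityZ3.Theorems.SahiE3LroExamples
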